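import Literature.AlgebraicGeometry.Morphisms.FlatProjectiveFamilyHilbertPolynomialLocallyConstantScheme
import Literature.AlgebraicGeometry.Morphisms.ProjectiveSpaceOverBasePoints
import Literature.AlgebraicGeometry.Modules.ProjectiveFamilyTwistPushforward
import HarnessLib

/-!
# The Hilbert polynomial of a flat family `Z ⊆ 𝐏(ι; T)` under base change, and `(p_Z)_*𝒪_Z(e)` on the pieces where it is constant

Layer `Literature/AlgebraicGeometry/Morphisms`, namespace `Literature.AlgebraicGeometry.Morphisms`.  Theorems only: no definition, no
named fact, no instance, no notation, no `sorry`.  Universe `0`.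

Model of record: `i : Z ⟶ 𝐏(ι; T)` a closed immersion, `p_Z = i ≫ projectiveSpaceFst ι T`, `𝒪_Z(e) = SerreTwist.twistMod (i ≫ pr₂)
(unitModule Z) e`, field points `(k, f₀, x)` with `IsPullback k f₀ p_Z x`, and the LETTERS `Ext¹(𝒪_{X₀}, k^*𝒪_Z(e)) = 0`,
`dim_K Γ(X₀, k^*𝒪_Z(e)) = P(e)` (★ `Morphisms/FlatProjectiveFamilyHilbertPolynomialLocallyConstantScheme`).

* §1 `exists_fieldPoint_of_baseChange` — a base change `Z' = Z ×_{𝐏(ι;T)} 𝐏(ι; T')` of the embedded family along `v : T' → T` (a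
  cartesian square over ★ `projectiveSpaceMap ι v`) reads, at a field point `x'` of `T'`, the fibre of `Z` at `x' ≫ v` and the same
  module: `k'^*𝒪_{Z'}(e) ≅ (k' ≫ g)^*𝒪_Z(e)` (★ `isPullback_projectiveSpaceMap`, ★ `SerreTwist.exists_pullback_twistMod_unitModule_iso`).
* §2 **`exists_isLocallyConstant_hilbertPolynomial_baseChange`** — the locally constant Hilbert polynomial `P : T → ℚ[X]` of ★
  `exists_isLocallyConstant_hilbertPolynomial_scheme` serves EVERY base change: at a field point `x'` of `T'` both letters hold for
  `Z'` with `P (v t')` (EGA III 7.9.11: `P_{T'} = P_T ∘ v`; Hartshorne III 9.9).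
* §3 **`hasRank_pushforward_twistMod_of_letters`** — on a base where the letters hold at every field point with ONE polynomial `Q`,
  `(p_Z)_*𝒪_Z(e)` is locally free of rank `⌊Q(e)⌋₊` for every `e ≥ B(Q) − 1` (★ `Modules.hasRank_pushforward_twistMod_of_forall_fieldPoint`),
  and `⌊Q(e)⌋₊ = Q(e)` as soon as the base has a point.
* §4 **`exists_isLocallyConstant_hilbertPolynomial_hasRank_pieces`** — THE PIECES: one locally constant `P`, and over every open `U` on
  which `P ≡ Q` the restricted family `Z_U ⊆ 𝐏(ι; U)` has `(p_{Z_U})_*𝒪_{Z_U}(e)` locally free of rank `⌊Q(e)⌋₊ = Q(e)` for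
  `e ≥ B(Q) − 1` — the hypothesis of ★ `Motives.exists_universal_flat_family` on each clopen piece `{P = Q}` (Mumford, Lect. 8, 3° (ii)).

Cell hodgecm-mathlib, F-4 (II-b) Hom-scheme assembly (b4) (B-p20 (g14) census v2 §2 (b4): `T = ⨆_Q T_Q` and the Hilb hypothesis per
piece), B-p14 (g20).  Count-neutral capital: HC_CM is proved only modulo the 7 printed citations until rung 0 closes; nothing here
bears on it.

## References

* R. Hartshorne, *Algebraic Geometry*, GTM 52 (1977), III Thm. 9.9 (p. 261), III Thm. 12.11 (p. 290). [Hartshorne1977]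
* A. Grothendieck, *EGA III₂* (Publ. Math. IHÉS 17, 1963), 7.9.11. [EGAIII2]
* D. Mumford, *Lectures on Curves on an Algebraic Surface* (1966), Lecture 8, 3° (ii); Lecture 15 (II.). [Mumford1966CurvesSurface]
* The Stacks Project, Tag 01NF (base change of `𝐏ⁿ_S`). [StacksProject]
-/

noncomputable section

set_option backward.isDefEq.respectTransparency false

open CategoryTheory CategoryTheory.Limits CategoryTheory.Abelian AlgebraicGeometry TopologicalSpace Opposite Polynomial
open Literature.Algebra.Homology Literature.Algebra.Homology.LaurentCech Literature.Algebra.Homology.OrderedCech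
open Literature.AlgebraicGeometry.Morphisms.ProjCech
open Literature.AlgebraicGeometry.Modules Literature.AlgebraicGeometry.Modules.SerreTwist Literature.AlgebraicGeometry.Motives

namespace Literature.AlgebraicGeometry.Morphisms

/-- `Ext`-vanishing transports along an isomorphism of the second argument. [folklore] -/
private theorem subsingleton_ext_of_iso₄ {C : Type*} [Category C] [Abelian C] [HasExt.{1} C] (P : C) {Y Y' : C}
    (e : Y ≅ Y') (i : ℕ) (h : Subsingleton (Ext.{1} P Y' i)) : Subsingleton (Ext.{1} P Y i) := by
  refine subsingleton_of_forall_eq 0 fun x => ?_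
  have hx : x = (x.comp (Ext.mk₀ e.hom) (add_zero i)).comp (Ext.mk₀ e.inv) (add_zero i) := by
    rw [Ext.comp_assoc_of_second_deg_zero, Ext.mk₀_comp_mk₀, e.hom_inv_id, Ext.comp_mk₀_id]
  rw [hx, Subsingleton.elim (x.comp (Ext.mk₀ e.hom) (add_zero i)) 0, Ext.zero_comp]

variable {ι : Type} {T Z : Scheme.{0}} (i : Z ⟶ Morphisms.projectiveSpace ι T)

/-! ## §1 A field point of a base change reads the fibre of `Z` and the same module -/

/-- **Base change of the embedded family and its field points.**  For `v : T' → T` and a cartesian square `g : Z' → Z` over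
`projectiveSpaceMap ι v : 𝐏(ι; T') → 𝐏(ι; T)` (so `Z' = Z ×_T T'` embedded by `i'`), a cartesian square `(k', f₀)` of `Z'` over a field
point `x'` of `T'` gives the cartesian square `(k' ≫ g, f₀)` of `Z` over `x' ≫ v`, and `(k' ≫ g)^*𝒪_Z(e) ≅ k'^*𝒪_{Z'}(e)` — because
`i' ≫ pr₂ = g ≫ i ≫ pr₂` (★ `projectiveSpaceMap_snd`) and `g^*𝒪_Z(e) ≅ 𝒪_{Z'}(e)` for twists read through the same map to `𝐏ⁿ_ℤ`
(★ `SerreTwist.exists_pullback_twistMod_unitModule_iso`). [cite: StacksProject, Tag 01NF] [cite: Hartshorne1977, II Prop. 5.12 (c)] -/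
theorem exists_fieldPoint_of_baseChange {T' Z' : Scheme.{0}} (v : T' ⟶ T) (g : Z' ⟶ Z)
    (i' : Z' ⟶ Morphisms.projectiveSpace ι T') (Hg : IsPullback g i' i (Morphisms.projectiveSpaceMap ι v))
    {K : Type} [Field K] {X₀ : Scheme.{0}} (k' : X₀ ⟶ Z') (f₀ : X₀ ⟶ Spec (CommRingCat.of K))
    (x' : Spec (CommRingCat.of K) ⟶ T') (H' : IsPullback k' f₀ (i' ≫ Morphisms.projectiveSpaceFst ι T') x') :
    IsPullback (k' ≫ g) f₀ (i ≫ Morphisms.projectiveSpaceFst ι T) (x' ≫ v) ∧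
      ∀ e : ℕ, Nonempty ((Scheme.Modules.pullback (k' ≫ g)).obj
          (twistMod (i ≫ pullback.snd (terminal.from T) (terminal.from (Morphisms.projectiveSpaceInt ι))) (unitModule Z) e) ≅
        (Scheme.Modules.pullback k').obj
          (twistMod (i' ≫ pullback.snd (terminal.from T') (terminal.from (Morphisms.projectiveSpaceInt ι))) (unitModule Z') e)) := by
  -- `Z' = Z ×_T T'` for the structure maps
  have HZ : IsPullback g (i' ≫ Morphisms.projectiveSpaceFst ι T') (i ≫ Morphisms.projectiveSpaceFst ι T) v :=
    Hg.paste_vert (Morphisms.isPullback_projectiveSpaceMap ι v)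
  refine ⟨H'.paste_horiz HZ, fun e => ?_⟩
  -- `i' ≫ pr₂ = g ≫ (i ≫ pr₂)`
  have hsnd : i' ≫ pullback.snd (terminal.from T') (terminal.from (Morphisms.projectiveSpaceInt ι)) =
      g ≫ (i ≫ pullback.snd (terminal.from T) (terminal.from (Morphisms.projectiveSpaceInt ι))) := by
    rw [← Morphisms.projectiveSpaceMap_snd ι v, ← Category.assoc, ← Hg.w, Category.assoc]
  obtain ⟨φ, -⟩ := exists_pullback_twistMod_unitModule_iso g
    (i ≫ pullback.snd (terminal.from T) (terminal.from (Morphisms.projectiveSpaceInt ι))) e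
  have hobj : twistMod (i' ≫ pullback.snd (terminal.from T') (terminal.from (Morphisms.projectiveSpaceInt ι))) (unitModule Z') e =
      twistMod (g ≫ (i ≫ pullback.snd (terminal.from T) (terminal.from (Morphisms.projectiveSpaceInt ι)))) (unitModule Z') e :=
    congrArg (fun f => twistMod f (unitModule Z') e) hsnd
  exact ⟨((Scheme.Modules.pullbackComp k' g).app _).symm ≪≫ (Scheme.Modules.pullback k').mapIso (φ ≪≫ eqToIso hobj.symm)⟩

/-! ## §2 The locally constant Hilbert polynomial serves every base change -/

include i in
/-- **`P_{T'} = P_T ∘ v`: the Hilbert polynomial of a flat family is compatible with base change** (EGA III 7.9.11; Hartshorne III 9.9).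
For `T` locally Noetherian and `Z ⊆ 𝐏(ι; T)` closed and flat over `T` there is a LOCALLY CONSTANT `P : T → ℚ[X]` such that for EVERY
`v : T' → T`, every cartesian `Z' = Z ×_{𝐏(ι;T)} 𝐏(ι; T')`, every field point `x'` of `T'` with cartesian square `(k', f₀)` of `Z'`, the
point `t` hit by `x' ≫ v` and every `e ≥ B(P t) − 1`: `Ext¹(𝒪_{X₀}, k'^*𝒪_{Z'}(e)) = 0` and `dim_K Γ(X₀, k'^*𝒪_{Z'}(e)) = (P t)(e)` (★
`exists_isLocallyConstant_hilbertPolynomial_scheme` at the composite field point, §1 for the module).  With `v = 𝟙` this is the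
statement for `Z` itself; with `v` the open immersion of a level set `{P = Q}` it feeds §3.
[cite: EGAIII2, 7.9.11] [cite: Hartshorne1977, III Thm. 9.9 (p. 261)] -/
theorem exists_isLocallyConstant_hilbertPolynomial_baseChange [IsLocallyNoetherian T] [IsClosedImmersion i]
    [Flat (i ≫ Morphisms.projectiveSpaceFst ι T)] (hr : 1 ≤ Nat.card ι) :
    ∃ P : T → ℚ[X], IsLocallyConstant P ∧
      ∀ ⦃T' Z' : Scheme.{0}⦄ (v : T' ⟶ T) (g : Z' ⟶ Z) (i' : Z' ⟶ Morphisms.projectiveSpace ι T'),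
        IsPullback g i' i (Morphisms.projectiveSpaceMap ι v) →
        ∀ ⦃K : Type⦄ [Field K] ⦃X₀ : Scheme.{0}⦄ (k' : X₀ ⟶ Z') (f₀ : X₀ ⟶ Spec (CommRingCat.of K))
          (x' : Spec (CommRingCat.of K) ⟶ T'), IsPullback k' f₀ (i' ≫ Morphisms.projectiveSpaceFst ι T') x' →
          ∀ t : T, t ∈ Set.range (x' ≫ v).base →
          ∀ e : ℕ, regularityBound (preHilbertPoly ℚ (Nat.card ι) 0) 0 (preHilbertPoly ℚ (Nat.card ι) 0 - P t) - 1 ≤ (e : ℤ) →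
            Subsingleton (Ext.{1} (unitModule X₀) ((Scheme.Modules.pullback k').obj
              (twistMod (i' ≫ pullback.snd (terminal.from T') (terminal.from (Morphisms.projectiveSpaceInt ι)))
                (unitModule Z') e)) 1) ∧
            ((Module.finrank Γ(Spec (CommRingCat.of K), ⊤) (SecMod ((Scheme.Modules.pullback k').obj
              (twistMod (i' ≫ pullback.snd (terminal.from T') (terminal.from (Morphisms.projectiveSpaceInt ι)))
                (unitModule Z') e)) f₀.appTop.hom ⊤) : ℕ) : ℚ) = (P t).eval (e : ℚ) := by
  obtain ⟨P, hP, hlet⟩ := exists_isLocallyConstant_hilbertPolynomial_scheme i hr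
  refine ⟨P, hP, fun T' Z' v g i' Hg K _ X₀ k' f₀ x' H' t ht e he => ?_⟩
  obtain ⟨H, hψ⟩ := exists_fieldPoint_of_baseChange i v g i' Hg k' f₀ x' H'
  obtain ⟨hvan, hrk⟩ := hlet (k' ≫ g) f₀ (x' ≫ v) H t ht e he
  refine ⟨subsingleton_ext_of_iso₄ (unitModule X₀) (hψ e).some.symm 1 hvan, ?_⟩
  obtain ⟨L, -⟩ := exists_secMod_linearEquiv_of_iso f₀.appTop.hom (hψ e).some
  rw [← L.finrank_eq]
  exact hrk

/-! ## §3 `(p_Z)_*𝒪_Z(e)` on a base where the letters hold with ONE polynomial -/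

include i in
/-- **On a piece where the Hilbert polynomial is the constant `Q`, `(p_Z)_*𝒪_Z(e)` is locally free of rank `⌊Q(e)⌋₊ = Q(e)` for
`e ≥ B(Q) − 1`** (Mumford, Lect. 8, 3° (ii) with Lect. 15 (II.); Hartshorne III 12.11): if at every field point of the locally
Noetherian base `T` both letters hold with `Q` from `B(Q) − 1` on, then ★ `Modules.hasRank_pushforward_twistMod_of_forall_fieldPoint`
applies with the rank `⌊Q(e)⌋₊`, and `⌊Q(e)⌋₊ = Q(e)` in `ℚ` whenever `T` has a point (the value is a dimension).  This is the
hypothesis `∀ e ≥ e₀, HasRank ((p_Z)_*𝒪_Z(e)) (R e)` of ★ `Motives.exists_universal_flat_family` on that piece.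
[cite: Mumford1966CurvesSurface, Lecture 8, 3° (ii) and Lecture 15 (II.)] [cite: Hartshorne1977, III Thm. 12.11 (p. 290)] -/
theorem hasRank_pushforward_twistMod_of_letters [IsLocallyNoetherian T] [IsClosedImmersion i]
    [Flat (i ≫ Morphisms.projectiveSpaceFst ι T)] (Q : ℚ[X])
    (hlet : ∀ ⦃K : Type⦄ [Field K] ⦃X₀ : Scheme.{0}⦄ (k : X₀ ⟶ Z) (f₀ : X₀ ⟶ Spec (CommRingCat.of K))
      (x : Spec (CommRingCat.of K) ⟶ T), IsPullback k f₀ (i ≫ Morphisms.projectiveSpaceFst ι T) x →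
      ∀ e : ℕ, regularityBound (preHilbertPoly ℚ (Nat.card ι) 0) 0 (preHilbertPoly ℚ (Nat.card ι) 0 - Q) - 1 ≤ (e : ℤ) →
        Subsingleton (Ext.{1} (unitModule X₀) ((Scheme.Modules.pullback k).obj
          (twistMod (i ≫ pullback.snd (terminal.from T) (terminal.from (Morphisms.projectiveSpaceInt ι)))
            (unitModule Z) e)) 1) ∧
        ((Module.finrank Γ(Spec (CommRingCat.of K), ⊤) (SecMod ((Scheme.Modules.pullback k).obj
          (twistMod (i ≫ pullback.snd (terminal.from T) (terminal.from (Morphisms.projectiveSpaceInt ι)))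
            (unitModule Z) e)) f₀.appTop.hom ⊤) : ℕ) : ℚ) = Q.eval (e : ℚ))
    (e : ℕ) (he : regularityBound (preHilbertPoly ℚ (Nat.card ι) 0) 0 (preHilbertPoly ℚ (Nat.card ι) 0 - Q) - 1 ≤ (e : ℤ)) :
    HasRank ((Scheme.Modules.pushforward (i ≫ Morphisms.projectiveSpaceFst ι T)).obj
        (twistMod (i ≫ pullback.snd (terminal.from T) (terminal.from (Morphisms.projectiveSpaceInt ι))) (unitModule Z) e))
      ⌊Q.eval (e : ℚ)⌋₊ ∧
    (Nonempty T → ((⌊Q.eval (e : ℚ)⌋₊ : ℕ) : ℚ) = Q.eval (e : ℚ)) := by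
  have hrank : ∀ ⦃K : Type⦄ [Field K] ⦃X₀ : Scheme.{0}⦄ (k : X₀ ⟶ Z) (f₀ : X₀ ⟶ Spec (CommRingCat.of K))
      (x : Spec (CommRingCat.of K) ⟶ T), IsPullback k f₀ (i ≫ Morphisms.projectiveSpaceFst ι T) x →
      Module.finrank Γ(Spec (CommRingCat.of K), ⊤) (SecMod ((Scheme.Modules.pullback k).obj
        (twistMod (i ≫ pullback.snd (terminal.from T) (terminal.from (Morphisms.projectiveSpaceInt ι)))
          (unitModule Z) e)) f₀.appTop.hom ⊤) = ⌊Q.eval (e : ℚ)⌋₊ := fun K _ X₀ k f₀ x H => by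
    have h := (hlet k f₀ x H e he).2
    rw [← h, Nat.floor_natCast]
  refine ⟨Modules.hasRank_pushforward_twistMod_of_forall_fieldPoint i e _
    (fun K _ X₀ k f₀ x H => (hlet k f₀ x H e he).1) hrank, fun ⟨t⟩ => ?_⟩
  -- at the residue field of a point the value `Q(e)` is a dimension
  have H := IsPullback.of_hasPullback (i ≫ Morphisms.projectiveSpaceFst ι T) (T.fromSpecResidueField t)
  have h := (hlet (K := IsLocalRing.ResidueField (T.presheaf.stalk t)) (pullback.fst _ _) (pullback.snd _ _)
    (T.fromSpecResidueField t) H e he).2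
  rw [← h, Nat.floor_natCast]

/-! ## §4 The clopen pieces: `(p_Z)_*𝒪_Z(e)` is locally free of rank `Q(e)` over every open on which the polynomial is `Q` -/

include i in
/-- **The pieces of the base.**  For `T` locally Noetherian and `Z ⊆ 𝐏(ι; T)` closed and flat over `T` there is a LOCALLY CONSTANT
`P : T → ℚ[X]` (so every level set `{t | P t = Q}` is clopen, Mathlib `IsLocallyConstant.isClopen_fiber`) such that over EVERY open
`U ⊆ T` on which `P` is the constant `Q`, the restricted family `Z_U = Z ×_{𝐏(ι;T)} 𝐏(ι; U) ⊆ 𝐏(ι; U)` (Mathlib `pullback.snd i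
(projectiveSpaceMap ι U.ι)`) satisfies, for every `e ≥ B(Q) − 1`: **`(p_{Z_U})_*𝒪_{Z_U}(e)` is locally free of rank `⌊Q(e)⌋₊`**, and
`⌊Q(e)⌋₊ = Q(e)` if `U` is non-empty — the hypothesis `∀ e ≥ e₀, HasRank ((p_Z)_*𝒪_Z(e)) (R e)` of ★ `Motives.exists_universal_flat_family`
piece by piece (Mumford, Lect. 8, 3° (ii): «only a finite number of polynomials occur» on a Noetherian base; EGA III 7.9.11).
[cite: EGAIII2, 7.9.11] [cite: Mumford1966CurvesSurface, Lecture 8, 3° (ii) and Lecture 15 (II.)] [cite: Hartshorne1977, III Thm. 9.9 (p. 261)] -/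
theorem exists_isLocallyConstant_hilbertPolynomial_hasRank_pieces [IsLocallyNoetherian T] [IsClosedImmersion i]
    [Flat (i ≫ Morphisms.projectiveSpaceFst ι T)] (hr : 1 ≤ Nat.card ι) :
    ∃ P : T → ℚ[X], IsLocallyConstant P ∧
      ∀ (U : T.Opens) (Q : ℚ[X]), (∀ t : T, t ∈ U → P t = Q) →
        ∀ e : ℕ, regularityBound (preHilbertPoly ℚ (Nat.card ι) 0) 0 (preHilbertPoly ℚ (Nat.card ι) 0 - Q) - 1 ≤ (e : ℤ) →
          HasRank ((Scheme.Modules.pushforward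
              (pullback.snd i (Morphisms.projectiveSpaceMap ι U.ι) ≫ Morphisms.projectiveSpaceFst ι U)).obj
            (twistMod (pullback.snd i (Morphisms.projectiveSpaceMap ι U.ι) ≫
                pullback.snd (terminal.from (U : Scheme.{0})) (terminal.from (Morphisms.projectiveSpaceInt ι)))
              (unitModule (pullback i (Morphisms.projectiveSpaceMap ι U.ι))) e)) ⌊Q.eval (e : ℚ)⌋₊ ∧
          ((U : Set T).Nonempty → ((⌊Q.eval (e : ℚ)⌋₊ : ℕ) : ℚ) = Q.eval (e : ℚ)) := by
  obtain ⟨P, hP, hlet⟩ := exists_isLocallyConstant_hilbertPolynomial_baseChange i hr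
  refine ⟨P, hP, fun U Q hUQ e he => ?_⟩
  -- the restricted family `i_U : Z_U ⟶ 𝐏(ι; U)` is a closed, flat embedded family over the locally Noetherian `U`
  have Hg := IsPullback.of_hasPullback i (Morphisms.projectiveSpaceMap ι U.ι)
  set g := pullback.fst i (Morphisms.projectiveSpaceMap ι U.ι)
  set iU := pullback.snd i (Morphisms.projectiveSpaceMap ι U.ι)
  haveI : IsClosedImmersion iU := MorphismProperty.pullback_snd _ _ inferInstance
  haveI : Flat (iU ≫ Morphisms.projectiveSpaceFst ι U) :=
    MorphismProperty.of_isPullback (Hg.paste_vert (Morphisms.isPullback_projectiveSpaceMap ι U.ι)) inferInstance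
  -- the letters hold on `U` with the constant `Q`
  have hletU : ∀ ⦃K : Type⦄ [Field K] ⦃X₀ : Scheme.{0}⦄ (k : X₀ ⟶ pullback i (Morphisms.projectiveSpaceMap ι U.ι))
      (f₀ : X₀ ⟶ Spec (CommRingCat.of K)) (x : Spec (CommRingCat.of K) ⟶ (U : Scheme.{0})),
      IsPullback k f₀ (iU ≫ Morphisms.projectiveSpaceFst ι U) x →
      ∀ e : ℕ, regularityBound (preHilbertPoly ℚ (Nat.card ι) 0) 0 (preHilbertPoly ℚ (Nat.card ι) 0 - Q) - 1 ≤ (e : ℤ) →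
        Subsingleton (Ext.{1} (unitModule X₀) ((Scheme.Modules.pullback k).obj
          (twistMod (iU ≫ pullback.snd (terminal.from (U : Scheme.{0})) (terminal.from (Morphisms.projectiveSpaceInt ι)))
            (unitModule _) e)) 1) ∧
        ((Module.finrank Γ(Spec (CommRingCat.of K), ⊤) (SecMod ((Scheme.Modules.pullback k).obj
          (twistMod (iU ≫ pullback.snd (terminal.from (U : Scheme.{0})) (terminal.from (Morphisms.projectiveSpaceInt ι)))
            (unitModule _) e)) f₀.appTop.hom ⊤) : ℕ) : ℚ) = Q.eval (e : ℚ) := by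
    intro K _ X₀ k f₀ x H e he
    -- the point `t` hit by `x ≫ U.ι` lies in `U`, so `P t = Q`
    let t : T := (x ≫ U.ι).base (default : ↥(Spec (CommRingCat.of K)))
    have ht : t ∈ Set.range (x ≫ U.ι).base := ⟨_, rfl⟩
    have htU : t ∈ U := by
      change U.ι.base (x.base default) ∈ U
      exact (x.base default).2
    have hPt : P t = Q := hUQ t htU
    have he' : regularityBound (preHilbertPoly ℚ (Nat.card ι) 0) 0 (preHilbertPoly ℚ (Nat.card ι) 0 - P t) - 1 ≤ (e : ℤ) := by
      rw [hPt]; exact he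
    have h := hlet U.ι g iU Hg k f₀ x H t ht e he'
    rw [hPt] at h
    exact h
  refine ⟨(hasRank_pushforward_twistMod_of_letters iU Q hletU e he).1, fun ⟨t, htU⟩ => ?_⟩
  haveI : Nonempty (U : Scheme.{0}) := ⟨⟨t, htU⟩⟩
  exact (hasRank_pushforward_twistMod_of_letters iU Q hletU e he).2 inferInstance

end Literature.AlgebraicGeometry.Morphisms

end
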